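import Literature.MathematicalPhysics.QuantumFieldTheory.Balaban1983to89.T3TiltDescent
import Literature.MathematicalPhysics.QuantumFieldTheory.Balaban1983to89.T3HistoryTailReduction

/-!
# `Balaban1983to89.T3CruxEstimates` — rung R3: the two OPEN ESTIMATES behind the route `UnitScaleTilt`, NAMED (hypothesis schemas,
# never asserted), with the landed reductions restated by name: `HeightSandwichAt ⇒ UnitTiltAt` (K1) and `HeightTailAt ⇒ HistoryTailAt`
# for EVERY `m ≥ 1` (K2)

Cell `ym3-torus` (HUMAN RULING D-0037, YM ladder rung R3), seat `ym3-torus-p2` gen 3.  WHAT THIS IS NOT: not d = 4, not infinite volume,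
not a mass gap, not Clay, and neither estimate is proved here — both are the d = 3 expectations step, unpublished for any non-abelian
gauge theory ([Balaban1985UV3] prints the one-run envelope (41)/(47) of the restricted densities and the per-plaquette large-field
factor (71); [King1986] Thm 3.4 / Props 3.8–3.9 is the abelian two-cut-off template).  Naming them lets a crux lead register them as
stubs verbatim (`ledger skeleton check`) and lets a disprover attack them as stated.

* `HeightSandwichAt F γ b₀ p₀ m` (K1's estimate): summable radii `r_K ≥ 0` and FREE constants `c_K > 0` such that for every `K`,
  with `n = ⌊K/m⌋`, almost everywhere on the finest lattice of the `n`-th approximation (spacing `η = L^{-n}`, product Haar) the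
  restricted densities of the two consecutive approximations on Bałaban's UV-small-history events satisfy
  `e^{−r_K}c_K ρ^{(K),Gd_K}_{K−n} ≤ ρ^{(K+1),Gd'_K}_{K+1−n} ≤ e^{r_K}c_K ρ^{(K),Gd_K}_{K−n}`.
* `HeightTailAt F γ b₀ p₀` (K2's estimate, INDEPENDENT of `m`): a tail profile `q ≥ 0`, `Σ q < ∞`, `Σ_n Σ'_t q(t+n) < ∞`, with
  `Gibbs_K{¬PlaqSmall θ(K−j) (Ū^{j})} ≤ q(K−j)` for every approximation `K` and height `j ≤ K`.
* §0 tools: `isTilt_of_smul_le_le_smul` (density-free criterion: `Ce^{−r}μ ≤ ν ≤ Ce^{r}μ` setwise ⇒ `IsTilt μ ν r`) and its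
  converse `IsTilt.exists_smul_le_le_smul`; `real_not_plaqSmall_comp_le_sum` (single-height tail ≤ Σ over plaquettes of
  single-plaquette tails of the averaged field).
* `resDensity_ae_eq_zero_off`, `heightDensity_histGood_ae_eq_zero`: the restricted densities vanish a.e. off the small-field region
  their event remembers — K1's sandwich bites on the COMMON small-field region `{PlaqSmall θ(n)}` of the `η`-lattice only.
* `real_gibbsK_iter_mem`: `Gibbs_K{Ū^{j} ∈ E} = (∫_E ρ^{(K)}_j dV_j)/Z_K` — K2's estimate is the relative weight of [Balaban1985UV3]'s
  density `ρ_j` on the height-`j` large-field region; `heightTailAt_of_densityTail`.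
* `unitTiltAt_of_heightSandwichAt`, `historyTailAt_of_heightTailAt` (every `m ≥ 1`): the landed reductions
  (`T3TiltDescent.unitTiltAt_of_heightSandwich`, `T3HistoryTailReduction.historyTailAt_of_heightTail'`) by name; and the packaged
  consequence `continuumYM3Torus_of_heightEstimates`: both estimates under the route's quantifier prefixes ⇒ `∀ F, ∀ γ > 0,
  ContinuumYM3Torus F expMeanLogSU γ`.
-/

noncomputable section

open MeasureTheory Filter Topology
open Literature.MathematicalPhysics.QuantumFieldTheory.Balaban1983to89.T3ContinuumYM3Torus
open Literature.MathematicalPhysics.QuantumFieldTheory.Balaban1983to89.T3LevelShift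
open Literature.MathematicalPhysics.QuantumFieldTheory.Balaban1983to89.T3UnitLawDensityEML
open Literature.MathematicalPhysics.QuantumFieldTheory.Balaban1983to89.T3UnitScaleTilt
open Literature.MathematicalPhysics.QuantumFieldTheory.Balaban1983to89.T3RestrictedUnitDensity
open Literature.MathematicalPhysics.QuantumFieldTheory.Balaban1983to89.T3TiltDescent
open Literature.MathematicalPhysics.QuantumFieldTheory.Balaban1983to89.T3HistoryTailReduction
open Literature.MathematicalPhysics.QuantumFieldTheory.Balaban1983to89.Missing

namespace Literature.MathematicalPhysics.QuantumFieldTheory.Balaban1983to89.T3CruxEstimates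

/-! ## §0 Two density-free tools: tilts from setwise domination; single-height tails from single-plaquette tails -/

section Tools

variable {X : Type*} [MeasurableSpace X]

/-- **TILTS FROM SETWISE TWO-SIDED DOMINATION** (density-free criterion; `μ` finite, `C > 0`): if
`Ce^{−r}·μ ≤ ν ≤ Ce^{r}·μ` as measures then `IsTilt μ ν r` (Radon–Nikodym derivative in `[Ce^{−r}, Ce^{r}]` a.e., clipped; the
argument inside the tree's `IsTilt.map_measure`).  A K1 prover may thus establish the two-run comparison by bounding the two
restricted laws against each other on EVENTS, never writing a density. [cite: King1986, Thm 3.4 (3.9) p.656] -/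
theorem isTilt_of_smul_le_le_smul {μ ν : Measure X} [IsFiniteMeasure μ] {r C : ℝ} (hr : 0 ≤ r) (hC : 0 < C)
    (hlo : ENNReal.ofReal (C * Real.exp (-r)) • μ ≤ ν) (hhi : ν ≤ ENNReal.ofReal (C * Real.exp r) • μ) : IsTilt μ ν r := by
  classical
  set a : ℝ := C * Real.exp (-r) with ha
  set b : ℝ := C * Real.exp r with hb
  have ha0 : 0 < a := mul_pos hC (Real.exp_pos _)
  have hab : a ≤ b := mul_le_mul_of_nonneg_left (Real.exp_le_exp.mpr (by linarith)) hC.le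
  have hbounds : ∀ t, MeasurableSet t → ENNReal.ofReal a * μ t ≤ ν t ∧ ν t ≤ ENNReal.ofReal b * μ t := fun t _ =>
    ⟨by simpa only [Measure.smul_apply, smul_eq_mul] using hlo t, by simpa only [Measure.smul_apply, smul_eq_mul] using hhi t⟩
  haveI : IsFiniteMeasure ν := by
    refine ⟨lt_of_le_of_lt (hhi Set.univ) ?_⟩
    rw [Measure.smul_apply, smul_eq_mul]
    exact ENNReal.mul_lt_top ENNReal.ofReal_lt_top (measure_lt_top _ _)
  have hac : ν ≪ μ := Measure.absolutelyContinuous_of_le_smul hhi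
  set d := ν.rnDeriv μ with hd
  have hdm : Measurable d := Measure.measurable_rnDeriv _ _
  have hνd : ν = μ.withDensity d := (Measure.withDensity_rnDeriv_eq _ _ hac).symm
  have hset : ∀ t, MeasurableSet t → ∫⁻ x in t, d x ∂μ = ν t := fun t ht => by
    rw [hνd, withDensity_apply _ ht]
  have hup : d ≤ᵐ[μ] fun _ => ENNReal.ofReal b := by
    refine ae_le_of_forall_setLIntegral_le_of_sigmaFinite hdm fun t ht _ => ?_
    rw [hset t ht, setLIntegral_const]
    exact (hbounds t ht).2
  have hlo' : (fun _ => ENNReal.ofReal a) ≤ᵐ[μ] d := by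
    refine ae_le_of_forall_setLIntegral_le_of_sigmaFinite measurable_const fun t ht _ => ?_
    rw [hset t ht, setLIntegral_const]
    exact (hbounds t ht).1
  let ρ : X → ℝ := fun y => max a (min b (d y).toReal)
  have hρm : Measurable ρ := measurable_const.max (measurable_const.min hdm.ennreal_toReal)
  have hρa : ∀ y, a ≤ ρ y := fun y => le_max_left _ _
  have hρb : ∀ y, ρ y ≤ b := fun y => max_le hab (min_le_left _ _)
  have hρpos : ∀ y, 0 < ρ y := fun y => lt_of_lt_of_le ha0 (hρa y)
  let h' : X → ℝ := fun y => Real.log (ρ y / C)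
  have hh'm : Measurable h' := (hρm.div_const C).log
  have hh' : ∀ y, |h' y| ≤ r := by
    intro y
    have hq : 0 < ρ y / C := div_pos (hρpos y) hC
    have h1 : Real.exp (-r) ≤ ρ y / C := by
      rw [le_div_iff₀ hC]; have := hρa y; rw [ha] at this; linarith
    have h2 : ρ y / C ≤ Real.exp r := by
      rw [div_le_iff₀ hC]; have := hρb y; rw [hb] at this; linarith
    rw [abs_le]
    constructor
    · have := Real.log_le_log (Real.exp_pos _) h1; rwa [Real.log_exp] at this
    · have := Real.log_le_log hq h2; rwa [Real.log_exp] at this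
  have hCexp : ∀ y, C * Real.exp (h' y) = ρ y := fun y => by
    show C * Real.exp (Real.log (ρ y / C)) = ρ y
    rw [Real.exp_log (div_pos (hρpos y) hC)]
    field_simp
  refine ⟨hr, h', C, hh'm, hC.le, hh', ?_⟩
  rw [hνd]
  refine withDensity_congr_ae ?_
  filter_upwards [hup, hlo'] with y hyu hyl
  have htop : d y ≠ ⊤ := ne_top_of_le_ne_top ENNReal.ofReal_ne_top hyu
  have hreal : a ≤ (d y).toReal ∧ (d y).toReal ≤ b := by
    constructor
    · have := ENNReal.toReal_mono htop hyl
      rwa [ENNReal.toReal_ofReal ha0.le] at this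
    · have := ENNReal.toReal_mono ENNReal.ofReal_ne_top hyu
      rwa [ENNReal.toReal_ofReal (ha0.le.trans hab)] at this
  have hρy : ρ y = (d y).toReal := by
    show max a (min b (d y).toReal) = (d y).toReal
    rw [min_eq_right hreal.2, max_eq_right hreal.1]
  rw [hCexp, hρy, ENNReal.ofReal_toReal htop]

/-- **CONVERSELY, A TILT DOMINATES SETWISE**: `IsTilt μ ν r` gives `C ≥ 0` with `Ce^{−r}·μ ≤ ν ≤ Ce^{r}·μ`. [cite: King1986, Thm 3.4 (3.9) p.656] -/
theorem IsTilt.exists_smul_le_le_smul {μ ν : Measure X} {r : ℝ} (ht : IsTilt μ ν r) :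
    ∃ C : ℝ, 0 ≤ C ∧ ENNReal.ofReal (C * Real.exp (-r)) • μ ≤ ν ∧ ν ≤ ENNReal.ofReal (C * Real.exp r) • μ := by
  obtain ⟨_, g, C, _, hC, hg, hν⟩ := ht
  refine ⟨C, hC, Measure.le_iff.mpr fun s hs => ?_, Measure.le_iff.mpr fun s hs => ?_⟩
  · rw [Measure.smul_apply, smul_eq_mul, hν, withDensity_apply _ hs]
    calc ENNReal.ofReal (C * Real.exp (-r)) * μ s
        = ∫⁻ _ in s, ENNReal.ofReal (C * Real.exp (-r)) ∂μ := (setLIntegral_const _ _).symm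
      _ ≤ ∫⁻ x in s, ENNReal.ofReal (C * Real.exp (g x)) ∂μ :=
          lintegral_mono fun x => ENNReal.ofReal_le_ofReal
            (mul_le_mul_of_nonneg_left (Real.exp_le_exp.mpr (abs_le.mp (hg x)).1) hC)
  · rw [Measure.smul_apply, smul_eq_mul, hν, withDensity_apply _ hs]
    calc ∫⁻ x in s, ENNReal.ofReal (C * Real.exp (g x)) ∂μ
        ≤ ∫⁻ _ in s, ENNReal.ofReal (C * Real.exp r) ∂μ :=
          lintegral_mono fun x => ENNReal.ofReal_le_ofReal
            (mul_le_mul_of_nonneg_left (Real.exp_le_exp.mpr (abs_le.mp (hg x)).2) hC)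
      _ = ENNReal.ofReal (C * Real.exp r) * μ s := setLIntegral_const _ _

end Tools

section PlaquetteTails

variable {P : Params} {j : ℕ} {G : Type*} [GaugeGroup G]

/-- **A SINGLE-HEIGHT LARGE-FIELD EVENT IS A UNION OVER PLAQUETTES**: `{¬PlaqSmall θ V} = ⋃_p {θ ≤ dist(V(∂p), 1)}`.
[cite: Balaban1985UV3, (7) p.257] -/
theorem setOf_not_plaqSmall_eq (θ : ℝ) :
    {V : GaugeField P j G | ¬ PlaqSmall θ V} = ⋃ p : Plaq P j, {V | θ ≤ GaugeGroup.dist1 (GaugeField.plaqHol V p)} := by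
  ext V
  simp only [PlaqSmall, Set.mem_setOf_eq, not_forall, not_lt, Set.mem_iUnion]

/-- **UNION BOUND OVER PLAQUETTES, PULLED BACK ALONG ANY MAP** (e.g. the `j`-fold block averaging): for a finite measure `μ`,
`μ{U : ¬PlaqSmall θ (Φ U)} ≤ Σ_p μ{U : θ ≤ dist((Φ U)(∂p), 1)}` — K2's per-height tail reduces to single-plaquette tails of the
block-averaged field (the shape in which chessboard / [Balaban1985UV3] (71)-type bounds come). [cite: Balaban1985UV3, (71) p.273] -/
theorem real_not_plaqSmall_comp_le_sum {Y : Type*} [MeasurableSpace Y] (μ : Measure Y) [IsFiniteMeasure μ]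
    (Φ : Y → GaugeField P j G) (θ : ℝ) :
    μ.real {U | ¬ PlaqSmall θ (Φ U)} ≤ ∑ p : Plaq P j, μ.real {U | θ ≤ GaugeGroup.dist1 (GaugeField.plaqHol (Φ U) p)} := by
  have hset : {U | ¬ PlaqSmall θ (Φ U)} = ⋃ p : Plaq P j, {U | θ ≤ GaugeGroup.dist1 (GaugeField.plaqHol (Φ U) p)} := by
    ext U
    simp only [PlaqSmall, Set.mem_setOf_eq, not_forall, not_lt, Set.mem_iUnion]
  rw [hset]
  exact measureReal_iUnion_fintype_le _

end PlaquetteTails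

/-- **K1's ESTIMATE — THE TWO-RUN SANDWICH OF THE FULLY-CONSTRAINED RESTRICTED DENSITIES AT THE COMPARISON SCALE** (hypothesis
schema, never asserted; NOT PRINTED: [Balaban1985UV3] (41) is the one-run lower envelope of `ρ^{(K),Gd}_{K−n}`, [King1986] Thm 3.4 the
abelian two-cut-off template).  For one family `F`, coupling `γ`, profile `(b₀, p₀)` and free top fraction `1/m`. [cite: Balaban1985UV3, (41) p.266 and (47) p.267] -/
def HeightSandwichAt (F : T3Family) (γ b₀ p₀ : ℝ) (m : ℕ) : Prop :=
  ∃ (r c : ℕ → ℝ), Summable r ∧ (∀ K, 0 ≤ r K) ∧ (∀ K, 0 < c K) ∧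
    ∀ K, ∀ᵐ V ∂fieldMeasure (F.P (K / m)) 0 (Matrix.specialUnitaryGroup (Fin 2) ℂ),
      Real.exp (-r K) * c K *
            heightDensity F γ (Nat.div_le_self K m) (histGood F ℰp (θBal F.L γ b₀ p₀) K (K / m)) V ≤
          heightDensity F γ ((Nat.div_le_self K m).trans (Nat.le_succ K))
            (histGood F ℰp (θBal F.L γ b₀ p₀) (K + 1) (K / m)) V ∧
        heightDensity F γ ((Nat.div_le_self K m).trans (Nat.le_succ K))
            (histGood F ℰp (θBal F.L γ b₀ p₀) (K + 1) (K / m)) V ≤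
          Real.exp (r K) * c K *
            heightDensity F γ (Nat.div_le_self K m) (histGood F ℰp (θBal F.L γ b₀ p₀) K (K / m)) V

/-- **K2's ESTIMATE — ONE PER-HEIGHT LARGE-FIELD GIBBS TAIL, UNIFORM IN THE CUTOFF, INDEPENDENT OF `m`** (hypothesis schema, never
asserted; printed ingredient: the factor `exp(−¼p(g_j)²)` per large plaquette of [Balaban1985UV3] (71) inside the renormalization-group
representation; the Gibbs-probability statement is NOT printed). [cite: Balaban1985UV3, (71) p.273] -/
def HeightTailAt (F : T3Family) (γ b₀ p₀ : ℝ) : Prop :=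
  ∃ q : ℕ → ℝ, (∀ i, 0 ≤ q i) ∧ Summable q ∧ (Summable fun n => ∑' t, q (t + n)) ∧
    ∀ K j, j ≤ K → (gibbsK F ℰp γ K).real
      {U | ¬ PlaqSmall (θBal F.L γ b₀ p₀ (K - j))
        (Averaging.iter (fun i => BlockAveraging.blockAvg (P := F.P K) (j := i) ℰp) j U)} ≤ q (K - j)

/-- **RESTRICTED DENSITIES VANISH OFF THE EVENTS THEY REMEMBER**: if the restriction event `S` forces the height-`k` averaged field
into a measurable event `E` (`U ∈ S ⇒ Ū^{k} ∈ E`), then `ρ^S_k = 0` almost everywhere off `E` (push-forward identity with the test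
function `1_{Eᶜ}`; [Balaban1985UV3] (7): the characteristic functions `χ_k` in front of the small-field terms). [cite: Balaban1985UV3, (7) p.257] -/
theorem resDensity_ae_eq_zero_off (F : T3Family) {γ : ℝ} (hγ : 0 ≤ γ) (K : ℕ)
    {S : Set (GaugeField (F.P K) 0 (Matrix.specialUnitaryGroup (Fin 2) ℂ))} (hS : MeasurableSet S) {k : ℕ} (hk : k ≤ F.m + K)
    {E : Set (GaugeField (F.P K) k (Matrix.specialUnitaryGroup (Fin 2) ℂ))} (hE : MeasurableSet E)
    (hSE : ∀ U ∈ S, Averaging.iter (fun i => BlockAveraging.blockAvg (P := F.P K) (j := i) ℰp) k U ∈ E) :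
    ∀ᵐ V ∂fieldMeasure (F.P K) k (Matrix.specialUnitaryGroup (Fin 2) ℂ), V ∉ E → resDensity F γ K S k V = 0 := by
  have hb : ∀ W : GaugeField (F.P K) k (Matrix.specialUnitaryGroup (Fin 2) ℂ), |Eᶜ.indicator (fun _ => (1 : ℝ)) W| ≤ 1 := fun W => by
    by_cases hW : W ∈ Eᶜ <;> simp [hW]
  have key := integral_resDensity_mul F K hS hγ hk (Eᶜ.indicator (fun _ => (1 : ℝ))) (measurable_const.indicator hE.compl) ⟨1, hb⟩
  have hR : ∫ U, S.indicator (boltzmann (F.P K) ((F.scheme ℰp γ).β K)) U *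
      Eᶜ.indicator (fun _ => (1 : ℝ)) (Averaging.iter (fun i => BlockAveraging.blockAvg (P := F.P K) (j := i) ℰp) k U)
        ∂fieldMeasure (F.P K) 0 (Matrix.specialUnitaryGroup (Fin 2) ℂ) = 0 := by
    refine integral_eq_zero_of_ae (Eventually.of_forall fun U => ?_)
    by_cases hU : U ∈ S
    · have hmem : Averaging.iter (fun i => BlockAveraging.blockAvg (P := F.P K) (j := i) ℰp) k U ∉ Eᶜ :=
        fun h => h (hSE U hU)
      simp [Set.indicator_of_notMem hmem]
    · simp [Set.indicator_of_notMem hU]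
  rw [hR] at key
  have hnn : 0 ≤ fun V => resDensity F γ K S k V * Eᶜ.indicator (fun _ => (1 : ℝ)) V := fun V =>
    mul_nonneg (resDensity_nonneg F γ K S k V) (Set.indicator_nonneg (fun _ _ => zero_le_one) V)
  have hint : Integrable (fun V => resDensity F γ K S k V * Eᶜ.indicator (fun _ => (1 : ℝ)) V)
      (fieldMeasure (F.P K) k (Matrix.specialUnitaryGroup (Fin 2) ℂ)) := by
    have h1 := (integrable_resDensity F K hS hγ hk).bdd_mul (c := 1)
      ((measurable_const.indicator hE.compl).aestronglyMeasurable)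
      (Eventually.of_forall fun W => by rw [Real.norm_eq_abs]; exact hb W)
    refine h1.congr (Eventually.of_forall fun V => ?_)
    exact mul_comm _ _
  have hae := (integral_eq_zero_iff_of_nonneg hnn hint).mp key
  filter_upwards [hae] with V hV hVE
  have h1 : Eᶜ.indicator (fun _ => (1 : ℝ)) V = 1 := by simp [Set.indicator_of_mem (Set.mem_compl hVE)]
  have h2 : resDensity F γ K S k V * Eᶜ.indicator (fun _ => (1 : ℝ)) V = 0 := hV
  rw [h1, mul_one] at h2
  exact h2

/-- Small-field events are invariant under the level identification `fieldShift` (plaquettes correspond, `plaqHol_fieldShift`).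
[cite: Balaban1987RG1, (0.2) p.252] -/
theorem plaqSmall_fieldShift (F : T3Family) {m K j m' K' j' : ℕ}
    (h : (F.PP m K).sitesPerDir j = (F.PP m' K').sitesPerDir j') (δ : ℝ)
    (V : GaugeField (F.PP m' K') j' (Matrix.specialUnitaryGroup (Fin 2) ℂ)) :
    PlaqSmall δ (T3LevelShift.fieldShift h V) ↔ PlaqSmall δ V := by
  simp only [PlaqSmall, T3LevelShift.plaqHol_fieldShift h V]
  constructor
  · intro hV q
    have hq := hV ((T3LevelShift.plaqShift h).symm q)
    rwa [Equiv.apply_symm_apply] at hq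
  · intro hV p
    exact hV _

/-- **WHERE K1's ESTIMATE BITES**: the restricted density at the comparison height, `heightDensity … (histGood K n)`, VANISHES almost
everywhere off the small-field region `{V : PlaqSmall θ(n) V}` of the `η`-lattice (the event constrains the top remembered height with
threshold `θ(K − (K−n)) = θ(n)`); the same holds for run `K+1` with `histGood (K+1) n` (threshold `θ((K+1) − (K+1−n)) = θ(n)`).  Hence
the two-run sandwich `HeightSandwichAt` is an assertion on the COMMON small-field region only, where [Balaban1985UV3] (41) represents
both densities. [cite: Balaban1985UV3, (7) p.257 and (41) p.266] -/
theorem heightDensity_histGood_ae_eq_zero (F : T3Family) {γ : ℝ} (hγ : 0 ≤ γ) {n K : ℕ} (hK : n ≤ K) (θ : ℕ → ℝ) :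
    ∀ᵐ V ∂fieldMeasure (F.P n) 0 (Matrix.specialUnitaryGroup (Fin 2) ℂ),
      ¬ PlaqSmall (θ n) V → heightDensity F γ hK (histGood F ℰp θ K n) V = 0 := by
  -- the height-(K−n) small-field event of the K-th tower remembered by `histGood K n`
  let E : Set (GaugeField (F.P K) (K - n) (Matrix.specialUnitaryGroup (Fin 2) ℂ)) := {W | PlaqSmall (θ n) W}
  have hE : MeasurableSet E := measurableSet_plaqSmall _
  have hSE : ∀ U ∈ histGood F ℰp θ K n,
      Averaging.iter (fun i => BlockAveraging.blockAvg (P := F.P K) (j := i) ℰp) (K - n) U ∈ E := by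
    intro U hU
    have h := hU (K - n) (by omega)
    rwa [show K - (K - n) = n by omega] at h
  have hae := resDensity_ae_eq_zero_off F hγ K (measurableSet_histGood F ℰp measurableE_ℰp θ K n) (k := K - n) (by omega) hE hSE
  have hmp := measurePreserving_fieldShift (G := Matrix.specialUnitaryGroup (Fin 2) ℂ)
    (F.sitesPerDir_eq (m := F.m) (K := K) (j := K - n) (m' := F.m) (K' := n) (j' := 0) (by omega))
  filter_upwards [hmp.quasiMeasurePreserving.ae hae] with V hV hsmall
  refine hV fun hmem => hsmall ?_
  exact (plaqSmall_fieldShift F _ (θ n) V).mp hmem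

/-- **THE GIBBS PROBABILITY OF A HEIGHT-`j` EVENT IS THE RELATIVE MASS OF THE RENORMALISED DENSITY `ρ_j` ON IT**:
`Gibbs_K{U : Ū^{j} ∈ E} = (∫_E ρ^{(K)}_j dV_j)/Z_K` for every measurable event `E` of height-`j` fields (`j ≤ m + K`, `γ ≥ 0`; tree
`integral_emlDensity_mul` with the test function `1_E`).  So K2's estimate is a statement about the weight of [Balaban1985UV3]'s
density `ρ_j` on the large-field region at height `j` ((7): the terms with `χ^c`). [cite: Balaban1985UV3, (2) p.256 and (7) p.257] -/
theorem real_gibbsK_iter_mem (F : T3Family) {γ : ℝ} (hγ : 0 ≤ γ) (K j : ℕ) (hj : j ≤ F.m + K)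
    {E : Set (GaugeField (F.P K) j (Matrix.specialUnitaryGroup (Fin 2) ℂ))} (hE : MeasurableSet E) :
    (gibbsK F ℰp γ K).real {U | Averaging.iter (fun i => BlockAveraging.blockAvg (P := F.P K) (j := i) ℰp) j U ∈ E} =
      (∫ V in E, emlDensity F γ K j V ∂fieldMeasure (F.P K) j (Matrix.specialUnitaryGroup (Fin 2) ℂ)) /
        partitionFn (G := Matrix.specialUnitaryGroup (Fin 2) ℂ) (F.P K) ((F.scheme ℰp γ).β K) := by
  have hiter : Measurable (Averaging.iter (fun i => BlockAveraging.blockAvg (P := F.P K) (j := i) ℰp) j) :=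
    T4Continuum.measurable_iter _ (F.avgMeasurable_of_measurableE ℰp measurableE_ℰp K) j
  have hpre : MeasurableSet {U | Averaging.iter (fun i => BlockAveraging.blockAvg (P := F.P K) (j := i) ℰp) j U ∈ E} :=
    hiter hE
  rw [← integral_indicator_one hpre, gibbsK_eq, T4GenFunBounds.integral_gibbsMeasure _ (F.scheme_β_nonneg ℰp hγ K),
    ← integral_indicator hE]
  have key := integral_emlDensity_mul F K hγ j hj (E.indicator 1) (measurable_one.indicator hE)
    ⟨1, fun V => by by_cases hV : V ∈ E <;> simp [hV]⟩
  have hlhs : ∫ V, E.indicator (emlDensity F γ K j) V ∂fieldMeasure (F.P K) j (Matrix.specialUnitaryGroup (Fin 2) ℂ) =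
      ∫ V, emlDensity F γ K j V * E.indicator 1 V ∂fieldMeasure (F.P K) j (Matrix.specialUnitaryGroup (Fin 2) ℂ) := by
    refine integral_congr_ae (Eventually.of_forall fun V => ?_)
    by_cases hV : V ∈ E <;> simp [hV]
  rw [hlhs, key]
  congr 1
  refine integral_congr_ae (Eventually.of_forall fun U => ?_)
  show Set.indicator {U | Averaging.iter (fun i => BlockAveraging.blockAvg (P := F.P K) (j := i) ℰp) j U ∈ E}
      (1 : GaugeField (F.P K) 0 (Matrix.specialUnitaryGroup (Fin 2) ℂ) → ℝ) U * boltzmann (F.P K) ((F.scheme ℰp γ).β K) U =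
    boltzmann (F.P K) ((F.scheme ℰp γ).β K) U *
      E.indicator 1 (Averaging.iter (fun i => BlockAveraging.blockAvg (P := F.P K) (j := i) ℰp) j U)
  by_cases hU : Averaging.iter (fun i => BlockAveraging.blockAvg (P := F.P K) (j := i) ℰp) j U ∈ E
  · have hU' : U ∈ {U | Averaging.iter (fun i => BlockAveraging.blockAvg (P := F.P K) (j := i) ℰp) j U ∈ E} := hU
    rw [Set.indicator_of_mem hU', Set.indicator_of_mem hU]; simp [mul_comm]
  · have hU' : U ∉ {U | Averaging.iter (fun i => BlockAveraging.blockAvg (P := F.P K) (j := i) ℰp) j U ∈ E} := hU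
    rw [Set.indicator_of_notMem hU', Set.indicator_of_notMem hU]; simp

/-- **K2's ESTIMATE IN THE DENSITY CURRENCY ⇒ `HeightTailAt`**: if the renormalised density `ρ^{(K)}_j` of every approximation has
weight `≤ q(K−j)·Z_K` on the height-`j` large-field region `{V : ¬PlaqSmall θ(K−j) V}` (`j ≤ K`), for a profile `q ≥ 0` with
`Σ q`, `Σ_n Σ'_t q(t+n) < ∞`, then `HeightTailAt F γ b₀ p₀` (`γ ≥ 0`). [cite: Balaban1985UV3, (7) p.257 and (71) p.273] -/
theorem heightTailAt_of_densityTail (F : T3Family) {γ : ℝ} (hγ : 0 ≤ γ) (b₀ p₀ : ℝ) (q : ℕ → ℝ) (hq0 : ∀ i, 0 ≤ q i)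
    (hq : Summable q) (hqt : Summable fun n => ∑' t, q (t + n))
    (h : ∀ K j, j ≤ K →
      ∫ V in {V | ¬ PlaqSmall (θBal F.L γ b₀ p₀ (K - j)) V}, emlDensity F γ K j V
          ∂fieldMeasure (F.P K) j (Matrix.specialUnitaryGroup (Fin 2) ℂ) ≤
        q (K - j) * partitionFn (G := Matrix.specialUnitaryGroup (Fin 2) ℂ) (F.P K) ((F.scheme ℰp γ).β K)) :
    HeightTailAt F γ b₀ p₀ := by
  refine ⟨q, hq0, hq, hqt, fun K j hj => ?_⟩
  have hZ : 0 < partitionFn (G := Matrix.specialUnitaryGroup (Fin 2) ℂ) (F.P K) ((F.scheme ℰp γ).β K) :=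
    partitionFn_pos' _ (F.scheme_β_nonneg ℰp hγ K)
  have hE : MeasurableSet {V : GaugeField (F.P K) j (Matrix.specialUnitaryGroup (Fin 2) ℂ) |
      ¬ PlaqSmall (θBal F.L γ b₀ p₀ (K - j)) V} := (measurableSet_plaqSmall _).compl
  have e := real_gibbsK_iter_mem F hγ K j (by omega) hE
  rw [show {U : GaugeField (F.P K) 0 (Matrix.specialUnitaryGroup (Fin 2) ℂ) | ¬ PlaqSmall (θBal F.L γ b₀ p₀ (K - j))
      (Averaging.iter (fun i => BlockAveraging.blockAvg (P := F.P K) (j := i) ℰp) j U)} =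
    {U | Averaging.iter (fun i => BlockAveraging.blockAvg (P := F.P K) (j := i) ℰp) j U ∈
      {V : GaugeField (F.P K) j (Matrix.specialUnitaryGroup (Fin 2) ℂ) | ¬ PlaqSmall (θBal F.L γ b₀ p₀ (K - j)) V}} from rfl, e]
  exact (div_le_iff₀ hZ).mpr (h K j hj)

/-- **K1's estimate ⇒ the route's K1 body** (`γ ≥ 0`): tree `T3TiltDescent.unitTiltAt_of_heightSandwich` by name.
[cite: King1986, Thm 3.4 (3.9)-(3.13) p.656] -/
theorem unitTiltAt_of_heightSandwichAt (F : T3Family) {γ : ℝ} (hγ : 0 ≤ γ) {b₀ p₀ : ℝ} {m : ℕ}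
    (h : HeightSandwichAt F γ b₀ p₀ m) : UnitTiltAt F γ b₀ p₀ m := by
  obtain ⟨r, c, hr, hr0, hc, hs⟩ := h
  exact unitTiltAt_of_heightSandwich F hγ b₀ p₀ m hr hr0 c hc hs

/-- **K2's estimate ⇒ the route's K2 body FOR EVERY `m ≥ 1`** (`γ ≥ 0`): tree `T3HistoryTailReduction.historyTailAt_of_heightTail'`
by name — the free top fraction costs the factor `m` only. [cite: Balaban1985UV3, (71) p.273] -/
theorem historyTailAt_of_heightTailAt (F : T3Family) {γ : ℝ} (hγ : 0 ≤ γ) {b₀ p₀ : ℝ} {m : ℕ} (hm : 0 < m)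
    (h : HeightTailAt F γ b₀ p₀) : HistoryTailAt F γ b₀ p₀ m := by
  obtain ⟨q, hq0, hq, hqt, ht⟩ := h
  exact historyTailAt_of_heightTail' F hγ b₀ p₀ hm q hq0 hq hqt ht

/-- **BOTH ESTIMATES UNDER THE ROUTE'S QUANTIFIER PREFIXES ⇒ R3 THRESHOLD-FREE**: (K1-est) `∀ L, ∃ m ≥ 1, ∀ profile, ∃ γ₁ > 0,
∀ F γ ≤ γ₁, HeightSandwichAt F γ b₀ p₀ m` and (K2-est) `∀ L, ∃ profile, ∃ γ₁ > 0, ∀ F γ ≤ γ₁, HeightTailAt F γ b₀ p₀` (NO `m`)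
⇒ `∀ F, ∀ γ > 0, ContinuumYM3Torus F expMeanLogSU γ` (tree `continuumYM3Torus_of_K1_K2`). [cite: King1986, Thm 2.1 p.654] -/
theorem continuumYM3Torus_of_heightEstimates
    (h1 : ∀ L : ℕ, ∃ m : ℕ, 0 < m ∧ ∀ b₀ p₀ : ℝ, 0 < b₀ → 2 < p₀ → ∃ γ₁ : ℝ, 0 < γ₁ ∧
      ∀ (F : T3Family) (γ : ℝ), F.L = L → 0 < γ → γ ≤ γ₁ → HeightSandwichAt F γ b₀ p₀ m)
    (h2 : ∀ L : ℕ, ∃ b₀ p₀ γ₁ : ℝ, 0 < b₀ ∧ 2 < p₀ ∧ 0 < γ₁ ∧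
      ∀ (F : T3Family) (γ : ℝ), F.L = L → 0 < γ → γ ≤ γ₁ → HeightTailAt F γ b₀ p₀)
    (F : T3Family) {γ : ℝ} (hγ : 0 < γ) : ContinuumYM3Torus F ℰp γ := by
  refine continuumYM3Torus_of_K1_K2 (fun L => ?_) (fun L m hm => ?_) F hγ
  · obtain ⟨m, hm, h⟩ := h1 L
    refine ⟨m, hm, fun b₀ p₀ hb hp => ?_⟩
    obtain ⟨γ₁, hγ₁, h⟩ := h b₀ p₀ hb hp
    exact ⟨γ₁, hγ₁, fun F' γ' hL hγ' hle => unitTiltAt_of_heightSandwichAt F' hγ'.le (h F' γ' hL hγ' hle)⟩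
  · obtain ⟨b₀, p₀, γ₁, hb, hp, hγ₁, h⟩ := h2 L
    exact ⟨b₀, p₀, γ₁, hb, hp, hγ₁, fun F' γ' hL hγ' hle =>
      historyTailAt_of_heightTailAt F' hγ'.le hm (h F' γ' hL hγ' hle)⟩

end Literature.MathematicalPhysics.QuantumFieldTheory.Balaban1983to89.T3CruxEstimates

end
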